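import Literature.Geometry.GeometricMeasureTheory.CurrentsAdmissibleHomotopy
import Literature.Geometry.GeometricMeasureTheory.PushforwardRectifiable
import Literature.Geometry.GeometricMeasureTheory.CurrentsPolar
import Literature.Geometry.GeometricMeasureTheory.MassComplete
import HarnessLib

/-!
# Rectifiability of Lipschitz and admissible push-forwards (towards Federer 4.2.9)

Support file for the proof of the named fact
`Literature.Geometry.GeometricMeasureTheory.Federer1969_compactness_integralCurrents`
(Federer–Fleming compactness, [Federer1969, 4.2.17 (2)]). In the proof of the deformation theorem
4.2.9 Federer uses 4.1.30 (Lipschitz push-forwards of rectifiable currents are rectifiable) for the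
cubical retractions `σ_m ∘ τ_a`. The tree has 4.1.30 for SMOOTH maps
(`Current.IsRectifiable.pushforward_top`, `PushforwardRectifiable.lean`); the retractions are smooth
off a closed hyperplane arrangement which is uncharged after a generic translation
(`CubicalSmooth.lean`). This file bridges the two:

* `Current.IsRectifiable.of_tendsto_mass` — **`𝐌`-limits of rectifiable currents with supports in
  a fixed compact set are rectifiable** (4.1.24, from `Current.IsRectifiable.complete_mass`);
  `Current.IsRectifiable.restrictSet_top` — restrictions to Borel sets are rectifiable;
* `exists_contDiff_eqOn_nhds` — a map smooth at the points of an open `O ⊇ K` (`K` compact) agrees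
  near `K` with a smooth compactly supported (hence Lipschitz) map;
* `Current.IsRectifiable.lipPushforward_of_contDiffAt` — `F_# X ∈ 𝓡` for a rectifiable normal `X`
  with compact support and a Lipschitz `F` smooth near `spt X` (`F_# X` is then a smooth
  push-forward: `lipPushforward_congr`, `lipPushforward_eq_pushforward`, `pushforward_top`);
* `Current.IsRectifiable.lipPushforward_of_null` — **`F_# X ∈ 𝓡` when `F` is Lipschitz and smooth
  at the points of an open `O` with `‖X‖(V ∖ O) = 0`**: exhaust by `w = dist(·, V ∖ O) > s` at good
  levels (`CurrentsSlicingLipschitz.lean`), `𝐌(F_# X − F_# (X ⌞ {w > s})) ≤ Lip(F)^{m+1} ‖X‖{w ≤ s} → 0`;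
* `Current.IsRectifiable.admPush`, **`Current.IsRectifiable.admPushLim`** — the restricted
  push-forwards `P_r` and the admissible push-forward `g_{#v} S` of
  `CurrentsAdmissiblePushforward.lean` are rectifiable when `S` is and `g` is smooth off a
  `‖S‖`-null closed set (and maps `{v > 0} ∩ B` into a compact set, `B ⊇ spt S` open), the latter as
  the `𝐌`-limit of the `P_{r_j}` (`Current.IsRectifiable.exists_limit_of_tsum_mass_ne_top`).

## References

* H. Federer, *Geometric Measure Theory*, Springer 1969, 4.1.24, 4.1.30, 4.2.2, 4.2.9 (held copy
  `lit book:federernd-geometric-measure-theory`, PDF pp. 321, 327–328, 336–337, 344) [Federer1969].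
-/

noncomputable section

open scoped Distributions ENNReal NNReal Topology ContDiff InnerProductSpace
open MeasureTheory TopologicalSpace Set Filter Metric Function Module

namespace Literature.Geometry.GeometricMeasureTheory

set_option maxSynthPendingDepth 2

section MassLimit

variable {V : Type*} [NormedAddCommGroup V] [InnerProductSpace ℝ V] [FiniteDimensional ℝ V]
  [MeasurableSpace V] [BorelSpace V] {m : ℕ}

/-- **`𝐌`-limits of rectifiable currents are rectifiable** (supports in a fixed compact set):
`𝓡_{m,K}` is `𝐌`-closed [Federer1969, 4.1.24], from its `𝐌`-completeness
(`Current.IsRectifiable.complete_mass`). [cite: Federer1969, 4.1.24] -/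
theorem Current.IsRectifiable.of_tendsto_mass {K : Set V} (hK : IsCompact K)
    (R : ℕ → Current (⊤ : Opens V) m) (hR : ∀ i, (R i).IsRectifiable) (hRK : ∀ i, (R i).support ⊆ K)
    {T' : Current (⊤ : Opens V) m} (hlim : Tendsto (fun i => (R i - T').mass) atTop (𝓝 0)) :
    T'.IsRectifiable := by
  -- Cauchy in mass
  have hC : ∀ ε : ℝ≥0∞, 0 < ε → ∃ N, ∀ i, N ≤ i → ∀ j, N ≤ j → (R i - R j).mass < ε := by
    intro ε hε
    rcases eq_or_ne ε ⊤ with rfl | hεtop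
    · obtain ⟨N, hN⟩ := (ENNReal.tendsto_atTop_zero.1 hlim) 1 one_pos
      refine ⟨N, fun i hi j hj => ?_⟩
      calc (R i - R j).mass ≤ (R i - T').mass + (T' - R j).mass := Current.mass_sub_le _ _ _
        _ ≤ 1 + 1 := add_le_add (hN i hi) (by rw [Current.mass_sub_comm]; exact hN j hj)
        _ < ⊤ := by simp
    have hε2 : 0 < ε / 2 := ENNReal.half_pos hε.ne'
    obtain ⟨N, hN⟩ := (ENNReal.tendsto_atTop_zero.1 hlim) (ε / 2 / 2) (ENNReal.half_pos hε2.ne')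
    refine ⟨N, fun i hi j hj => ?_⟩
    calc (R i - R j).mass ≤ (R i - T').mass + (T' - R j).mass := Current.mass_sub_le _ _ _
      _ ≤ ε / 2 / 2 + ε / 2 / 2 := add_le_add (hN i hi) (by rw [Current.mass_sub_comm]; exact hN j hj)
      _ = ε / 2 := ENNReal.add_halves _
      _ < ε := ENNReal.half_lt_self hε.ne' hεtop
  obtain ⟨R', hR', -, hlim'⟩ := Current.IsRectifiable.complete_mass hK R hR hRK hC
  -- the two limits agree
  have hbound : ∀ i, (T' - R').mass ≤ (R i - T').mass + (R i - R').mass := fun i =>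
    calc (T' - R').mass ≤ (T' - R i).mass + (R i - R').mass := Current.mass_sub_le _ _ _
      _ = (R i - T').mass + (R i - R').mass := by rw [Current.mass_sub_comm]
  have h0 : (T' - R').mass = 0 := by
    have hsum : Tendsto (fun i => (R i - T').mass + (R i - R').mass) atTop (𝓝 0) := by
      simpa using hlim.add hlim'
    exact le_antisymm (ge_of_tendsto' hsum hbound) bot_le
  have : T' = R' := sub_eq_zero.1 (Current.eq_zero_of_mass_eq_zero _ h0)
  rw [this]; exact hR'

/-- **Restrictions of rectifiable currents to measurable sets are rectifiable.**
[cite: Federer1969, 4.1.28] -/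
theorem Current.IsRectifiable.restrictSet_top {T : Current (⊤ : Opens V) m} (hT : T.IsRectifiable)
    (hTr : T.IsRepresentable) {A : Set V} (hA : MeasurableSet A) : (hTr.restrictSet A hA).IsRectifiable := by
  obtain ⟨W, θ, ξ, hd, rfl⟩ := hT.1
  refine ⟨?_, ?_⟩
  · exact hd.isLocallyRectifiable_restrictSet hA
  · exact Current.isCompact_support_of_subset _ hT.2 (Current.support_subset _) (hTr.support_restrictSet_subset hA)

/-! ### Smooth compactly supported modifications of a map smooth near a compact set -/

omit [InnerProductSpace ℝ V] [FiniteDimensional ℝ V] [MeasurableSpace V] [BorelSpace V] in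
/-- **Cut-off modification**: if `F` is smooth at every point of an open `O` and `K ⊆ O` is compact,
there is a smooth compactly supported (hence Lipschitz) `G` agreeing with `F` on an open
neighbourhood of `K`. [folklore] -/
theorem exists_contDiff_eqOn_nhds [NormedSpace ℝ V] [FiniteDimensional ℝ V] {V' : Type*} [NormedAddCommGroup V']
    [NormedSpace ℝ V'] {F : V → V'} {O : Set V} (hO : IsOpen O) (hF : ∀ x ∈ O, ContDiffAt ℝ ∞ F x)
    {K : Set V} (hK : IsCompact K) (hKO : K ⊆ O) :
    ∃ (G : V → V') (U : Set V), ContDiff ℝ ∞ G ∧ HasCompactSupport G ∧ IsOpen U ∧ K ⊆ U ∧ Set.EqOn F G U := by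
  obtain ⟨χ, U, hU, hKU, hχ1, -, hχO⟩ :=
    exists_testFunction_eq_one_nhds_subset (Ω := (⊤ : Opens V)) hK hO (fun _ _ => trivial) hKO
  refine ⟨fun x => χ x • F x, U, ?_, ?_, hU, hKU, fun x hx => ?_⟩
  · refine contDiff_iff_contDiffAt.2 fun x => ?_
    by_cases hx : x ∈ tsupport ⇑χ
    · exact (χ.contDiff.contDiffAt).smul (hF x (hχO hx))
    · refine (contDiffAt_const (c := (0 : V'))).congr_of_eventuallyEq ?_
      filter_upwards [(isClosed_tsupport ⇑χ).isOpen_compl.mem_nhds hx] with y hy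
      rw [image_eq_zero_of_notMem_tsupport hy, zero_smul]
  · exact χ.hasCompactSupport.smul_right
  · show F x = χ x • F x
    rw [hχ1 x hx, one_smul]

/-! ### Lipschitz push-forwards along maps smooth off a null closed set -/

variable {V' : Type*} [NormedAddCommGroup V'] [InnerProductSpace ℝ V'] [FiniteDimensional ℝ V']
  [MeasurableSpace V'] [BorelSpace V']

/-- **A Lipschitz push-forward of a rectifiable normal current is rectifiable when the map is smooth
near the support**: if `F` is smooth at every point of an open `O ⊇ spt X`, then `F_# X ∈ 𝓡`
(cut `F` off to a smooth compactly supported `G = F` near `spt X`; `F_# X = G_# X` is the smooth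
push-forward, rectifiable by `Current.IsRectifiable.pushforward_top`, Federer 4.1.30).
[cite: Federer1969, 4.1.14, 4.1.30] -/
theorem Current.IsRectifiable.lipPushforward_of_contDiffAt {X : Current (⊤ : Opens V) (m + 1)}
    (hXr : X.IsRectifiable) (hX : X.mass ≠ ⊤) (hdX : X.boundary.mass ≠ ⊤) (hsupp : IsCompact X.support)
    {F : V → V'} {L : ℝ≥0} (hF : LipschitzWith L F) {O : Set V} (hO : IsOpen O)
    (hFO : ∀ x ∈ O, ContDiffAt ℝ ∞ F x) (hXO : X.support ⊆ O) :
    (X.lipPushforward hX hdX hsupp hF ⊤).IsRectifiable := by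
  obtain ⟨G, U, hG, hGc, hU, hXU, hFG⟩ := exists_contDiff_eqOn_nhds hO hFO hsupp hXO
  obtain ⟨C, hGlip⟩ := hG.lipschitzWith_of_hasCompactSupport hGc (by simp)
  rw [X.lipPushforward_congr hX hdX hsupp hF hGlip hU hXU hFG, X.lipPushforward_eq_pushforward hX hdX hsupp hGlip hG]
  obtain ⟨hUo, hTU, hχ1, -⟩ := X.cutoff_spec hsupp
  exact hXr.pushforward_top _ (fun x hx => hχ1 x (hTU hx)) hG

/-- Good levels of a `1`-Lipschitz exhaustion function below a given bound exist. [folklore] -/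
theorem exists_good_level {X : Current (⊤ : Opens V) (m + 1)} (hX : X.mass ≠ ⊤) (hdX : X.boundary.mass ≠ ⊤)
    {w : V → ℝ} (hw : LipschitzWith 1 w) {δ : ℝ} (hδ : 0 < δ) :
    ∃ s ∈ Set.Ioo 0 δ, ((X.isRepresentable_of_mass_ne_top hX).restrictSet {x | s < w x}
      (measurableSet_lt_of_continuous hw.continuous s)).boundary.mass ≠ ⊤ := by
  have hae := (X.isRepresentable_of_mass_ne_top hX).ae_mass_boundary_restrictSet_lt_top
    (X.boundary.isRepresentable_of_mass_ne_top hdX) hw hX hdX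
  have hfreq : ∃ᵐ s ∂(volume : Measure ℝ), s ∈ Set.Ioo 0 δ := by
    refine frequently_ae_mem_iff.2 ?_
    rw [Real.volume_Ioo]; simp [hδ]
  obtain ⟨s, hs, hgood⟩ := (hfreq.and_eventually hae).exists
  exact ⟨s, hs, hgood.ne⟩

/-- **Lipschitz push-forwards along maps smooth off a null closed set are rectifiable**: let `X` be a
rectifiable normal current with compact support, `F` globally Lipschitz and smooth at every point of
an open set `O` with `‖X‖(V ∖ O) = 0`. Then `F_# X ∈ 𝓡`. Proof: with `w = dist(·, V ∖ O)` and good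
levels `s ↓ 0`, `F_# (X ⌞ {w > s})` is rectifiable by the previous lemma (`F` is smooth near its
support) and `𝐌(F_# X − F_# (X ⌞ {w > s})) ≤ Lip(F)^{m+1} ‖X‖{w ≤ s} → ‖X‖(V ∖ O) = 0`; conclude by
`𝐌`-closedness of `𝓡`. [cite: Federer1969, 4.1.24, 4.1.30] -/
theorem Current.IsRectifiable.lipPushforward_of_null {X : Current (⊤ : Opens V) (m + 1)}
    (hXr : X.IsRectifiable) (hX : X.mass ≠ ⊤) (hdX : X.boundary.mass ≠ ⊤) (hsupp : IsCompact X.support)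
    {F : V → V'} {L : ℝ≥0} (hF : LipschitzWith L F) {O : Set V} (hO : IsOpen O)
    (hFO : ∀ x ∈ O, ContDiffAt ℝ ∞ F x) (hnull : X.variation Oᶜ = 0) :
    (X.lipPushforward hX hdX hsupp hF ⊤).IsRectifiable := by
  -- trivial case `O = univ`
  rcases Set.eq_empty_or_nonempty Oᶜ with hOc | hOc
  · have hOu : O = Set.univ := by rwa [Set.compl_empty_iff] at hOc
    exact hXr.lipPushforward_of_contDiffAt hX hdX hsupp hF hO hFO (by rw [hOu]; exact Set.subset_univ _)
  -- the exhaustion function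
  set w : V → ℝ := fun x => infDist x Oᶜ with hwdef
  have hw : LipschitzWith 1 w := lipschitz_infDist_pt Oᶜ
  have hwpos : ∀ {x}, 0 < w x → x ∈ O := fun {x} hx => by
    by_contra hxO
    have : w x = 0 := infDist_zero_of_mem (show x ∈ Oᶜ from hxO)
    linarith
  have hw0 : {x | w x ≤ 0} ⊆ Oᶜ := fun x (hx : w x ≤ 0) => by
    have h0 : w x = 0 := le_antisymm hx infDist_nonneg
    have := (mem_closure_iff_infDist_zero hOc).2 h0
    rwa [hO.isClosed_compl.closure_eq] at this
  set hT := X.isRepresentable_of_mass_ne_top hX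
  -- good levels `s_j ∈ (0, 1/(j+1))`
  choose s hs hgood using fun j : ℕ => exists_good_level hX hdX hw (δ := 1 / ((j : ℝ) + 1)) (by positivity)
  set Xj : ℕ → Current (⊤ : Opens V) (m + 1) := fun j =>
    hT.restrictSet {x | s j < w x} (measurableSet_lt_of_continuous hw.continuous (s j)) with hXj
  have hXjm : ∀ j, (Xj j).mass ≠ ⊤ := fun j => Current.mass_restrictSet_ne_top' _ hX _
  have hXjc : ∀ j, IsCompact (Xj j).support := fun j =>
    Current.isCompact_support_of_subset _ hsupp (Current.support_subset _) (hT.support_restrictSet_subset _)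
  have hXjr : ∀ j, (Xj j).IsRectifiable := fun j => hXr.restrictSet_top hT _
  -- the complementary pieces
  set Yj : ℕ → Current (⊤ : Opens V) (m + 1) := fun j =>
    hT.restrictSet {x | w x ≤ s j} (isClosed_le hw.continuous continuous_const).measurableSet with hYj
  have hsplit : ∀ j, X = Xj j + Yj j := by
    intro j
    rw [hXj, hYj, ← hT.restrictSet_union]
    · conv_lhs => rw [← hT.restrictSet_univ]
      congr 1
      ext x; simp only [Set.mem_univ, Set.mem_union, Set.mem_setOf_eq, true_iff]; exact lt_or_ge _ _
    · exact Set.disjoint_left.2 fun x (hx : s j < w x) (hx' : w x ≤ s j) => (not_le.2 hx) hx'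
  have hYjm : ∀ j, (Yj j).mass ≠ ⊤ := fun j => Current.mass_restrictSet_ne_top' _ hX _
  have hYjb : ∀ j, (Yj j).boundary.mass ≠ ⊤ := by
    intro j
    have e : Yj j = X - Xj j := by rw [hsplit j]; abel
    rw [e, sub_eq_add_neg, Current.boundary_add, Current.boundary_neg]
    refine ne_top_of_le_ne_top (ENNReal.add_ne_top.2 ⟨hdX, ?_⟩) (Current.mass_add_le _ _)
    rw [Current.mass_neg]; exact hgood j
  have hYjc : ∀ j, IsCompact (Yj j).support := fun j =>
    Current.isCompact_support_of_subset _ hsupp (Current.support_subset _) (hT.support_restrictSet_subset _)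
  -- the rectifiable approximants
  set Rj : ℕ → Current (⊤ : Opens V') (m + 1) := fun j => (Xj j).lipPushforward (hXjm j) (hgood j) (hXjc j) hF ⊤
  have hRjr : ∀ j, (Rj j).IsRectifiable := by
    intro j
    refine (hXjr j).lipPushforward_of_contDiffAt (hXjm j) (hgood j) (hXjc j) hF (O := {x | s j / 2 < w x})
      (isOpen_lt continuous_const hw.continuous) (fun x hx => hFO x (hwpos (lt_trans (half_pos (hs j).1) hx))) ?_
    -- `spt (X ⌞ {w > s}) ⊆ {w ≥ s} ⊆ {w > s/2}`
    refine (Current.IsRepresentable.support_restrictSet_subset_closure hT _).trans ?_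
    refine (closure_minimal (fun x (hx : s j < w x) => show s j ≤ w x from hx.le)
      (isClosed_le continuous_const hw.continuous)).trans fun x hx => ?_
    show s j / 2 < w x
    have : s j ≤ w x := hx
    linarith [(hs j).1]
  -- masses of the differences
  have hdiff : ∀ j, X.lipPushforward hX hdX hsupp hF ⊤ - Rj j =
      (Yj j).lipPushforward (hYjm j) (hYjb j) (hYjc j) hF ⊤ := by
    intro j
    have key := Current.lipPushforward_add' (Ω' := (⊤ : Opens V')) (T₁ := Xj j) (T₂ := Yj j)
      (hXjm j) (hgood j) (hXjc j) (hYjm j) (hYjb j) (hYjc j)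
      (by rw [← hsplit j]; exact hX) (by rw [← hsplit j]; exact hdX) (by rw [← hsplit j]; exact hsupp) hF
    rw [sub_eq_iff_eq_add']
    refine Eq.trans ?_ key
    congr 1
    exact hsplit j
  have hmass : ∀ j, (Rj j - X.lipPushforward hX hdX hsupp hF ⊤).mass ≤ (L : ℝ≥0∞) ^ (m + 1) * X.variation {x | w x ≤ s j} := by
    intro j
    rw [Current.mass_sub_comm, hdiff j]
    refine (Current.mass_lipPushforward_le _ _ (hYjb j) _ _).trans (mul_le_mul' le_rfl ?_)
    exact hT.mass_restrictSet_le _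
  -- `‖X‖{w ≤ s_j} → 0`
  have hvar : Tendsto (fun j => X.variation {x | w x ≤ s j}) atTop (𝓝 0) := by
    have hsub : ∀ j, X.variation {x | w x ≤ s j} ≤ X.variation {x | w x ≤ 1 / ((j : ℝ) + 1)} := fun j =>
      measure_mono fun x (hx : w x ≤ s j) => hx.trans (hs j).2.le
    have hanti : Antitone fun j : ℕ => {x : V | w x ≤ 1 / ((j : ℝ) + 1)} := by
      intro i j hij x (hx : w x ≤ 1 / ((j : ℝ) + 1))
      exact hx.trans (one_div_le_one_div_of_le (by positivity) (by exact_mod_cast Nat.add_le_add_right hij 1))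
    have hlim := tendsto_measure_iInter_atTop (μ := X.variation)
      (fun j => (isClosed_le hw.continuous continuous_const).measurableSet.nullMeasurableSet) hanti
      ⟨0, ne_top_of_le_ne_top hX (X.variation_le_mass _)⟩
    have hinter : ⋂ j : ℕ, {x : V | w x ≤ 1 / ((j : ℝ) + 1)} ⊆ Oᶜ := by
      refine Set.Subset.trans (fun x hx => ?_) hw0
      simp only [Set.mem_iInter, Set.mem_setOf_eq] at hx ⊢
      exact ge_of_tendsto' tendsto_one_div_add_atTop_nhds_zero_nat fun j => hx j
    have h0 : X.variation (⋂ j : ℕ, {x : V | w x ≤ 1 / ((j : ℝ) + 1)}) = 0 := measure_mono_null hinter hnull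
    rw [h0] at hlim
    exact tendsto_of_tendsto_of_tendsto_of_le_of_le tendsto_const_nhds hlim (fun j => bot_le) hsub
  have hlim : Tendsto (fun j => (Rj j - X.lipPushforward hX hdX hsupp hF ⊤).mass) atTop (𝓝 0) := by
    have := ENNReal.Tendsto.const_mul (a := (L : ℝ≥0∞) ^ (m + 1)) hvar (Or.inr (ENNReal.pow_ne_top ENNReal.coe_ne_top))
    rw [mul_zero] at this
    exact tendsto_of_tendsto_of_tendsto_of_le_of_le tendsto_const_nhds this (fun j => bot_le) hmass
  -- a common compact set containing the supports: `F(closedBall)`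
  obtain ⟨ρ, hρ⟩ := hsupp.isBounded.subset_closedBall 0
  set K : Set V' := closedBall (F 0) (L * (ρ + 1)) with hK
  have hKc : IsCompact K := isCompact_closedBall _ _
  have hFK : Set.MapsTo F (ball 0 (ρ + 1)) K := fun x hx => by
    rw [hK, mem_closedBall]
    calc dist (F x) (F 0) ≤ L * dist x 0 := hF.dist_le_mul x 0
      _ ≤ L * (ρ + 1) := mul_le_mul_of_nonneg_left (le_of_lt (mem_ball.1 hx)) L.coe_nonneg
  have hRjK : ∀ j, (Rj j).support ⊆ K := fun j =>
    Current.support_lipPushforward_subset_of_mapsTo _ _ (hgood j) _ hF isOpen_ball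
      (((hT.support_restrictSet_subset _).trans hρ).trans (closedBall_subset_ball (by linarith))) hKc.isClosed hFK
  exact Current.IsRectifiable.of_tendsto_mass hKc Rj hRjr hRjK hlim

end MassLimit

/-! ### Rectifiability of the admissible push-forward -/

section AdmissibleRectifiable

open Cubical

variable {V : Type*} [NormedAddCommGroup V] [InnerProductSpace ℝ V] [FiniteDimensional ℝ V]
  [MeasurableSpace V] [BorelSpace V] {n d : ℕ} {v : V → ℝ} {g : V → V} {C : ℝ}
  {S : Current (⊤ : Opens V) (d + 1)}

variable (b : OrthonormalBasis (Fin n) ℝ V) (hS : S.mass ≠ ⊤) (hsupp : IsCompact S.support)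
  (hv : Continuous v) (hadm : Admissible v g C) (hC : 0 ≤ C)

/-- **`P_r = (G_r)_# (S ⌞ {v > r})` is rectifiable** when `S` is rectifiable (and normal with compact
support) and `g` is smooth at every point of an open set `O` with `‖S‖(V ∖ O) = 0`
(`G_r = g` on the open set `{v > r/2} ⊇ spt (S ⌞ {v > r})`). [cite: Federer1969, 4.1.30, 4.2.2] -/
theorem Current.IsRectifiable.admPush (hSr : S.IsRectifiable) {O : Set V} (hO : IsOpen O)
    (hgO : ∀ x ∈ O, ContDiffAt ℝ ∞ g x) (hnull : S.variation Oᶜ = 0) {r : ℝ} (hr : 0 < r)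
    (hgood : (S.restrictAbove hS hv r).boundary.mass ≠ ⊤) :
    (S.admPush b hS hsupp hv hadm hC hr hgood).IsRectifiable := by
  set hT := S.isRepresentable_of_mass_ne_top hS
  have hXr : (S.restrictAbove hS hv r).IsRectifiable := hSr.restrictSet_top hT _
  unfold Current.admPush
  refine hXr.lipPushforward_of_null (S.mass_restrictAbove_ne_top hS hv r) hgood
    (S.isCompact_support_restrictAbove hS hsupp hv r) (hadm.lipschitzWith_ext b hC hr)
    (O := O ∩ {x | r / 2 < v x}) (hO.inter (isOpen_lt continuous_const hv)) (fun x hx => ?_) ?_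
  · -- `G_r = g` near `x`
    refine (hgO x hx.1).congr_of_eventuallyEq ?_
    filter_upwards [(isOpen_lt continuous_const hv).mem_nhds hx.2] with y hy
    exact hadm.ext_eqOn b hC hr (le_of_lt hy)
  · -- `‖S ⌞ {v > r}‖ (Oᶜ ∪ {v ≤ r/2}) = ‖S‖((Oᶜ ∪ {v ≤ r/2}) ∩ {v > r}) ≤ ‖S‖(Oᶜ) = 0`
    unfold Current.restrictAbove
    rw [hT.variation_restrictSet_eq hS _ (measurableSet_lt_of_continuous hv r),
      Measure.restrict_apply' (measurableSet_lt_of_continuous hv r)]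
    refine measure_mono_null (fun x hx => ?_) hnull
    simp only [Set.mem_inter_iff, Set.mem_compl_iff, Set.mem_setOf_eq, not_and, not_lt] at hx ⊢
    intro hxO
    have := hx.1 hxO
    linarith [hx.2]

/-- Support of `P_r` from a bounded localisation: if `g` maps `{v > 0} ∩ B` into the closed set `Z`
for an open `B ⊇ spt S`, then `spt P_r ⊆ Z`. [cite: Federer1969, 4.2.2] -/
theorem Current.support_admPush_subset' {r : ℝ} (hr : 0 < r)
    (hgood : (S.restrictAbove hS hv r).boundary.mass ≠ ⊤) {B : Set V} (hB : IsOpen B)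
    (hSB : S.support ⊆ B) {Z : Set V} (hZ : IsClosed Z) (hgZ : Set.MapsTo g ({x | 0 < v x} ∩ B) Z) :
    (S.admPush b hS hsupp hv hadm hC hr hgood).support ⊆ Z := by
  refine Current.support_lipPushforward_subset_of_mapsTo _ _ hgood _ (hadm.lipschitzWith_ext b hC hr)
    (N := {x | r / 2 < v x} ∩ B) ((isOpen_lt continuous_const hv).inter hB)
    (Set.subset_inter ((S.support_restrictAbove_subset hS hv r).trans fun x hx => ?_)
      (((S.isRepresentable_of_mass_ne_top hS).support_restrictSet_subset _).trans hSB)) hZ fun x hx => ?_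
  · show r / 2 < v x
    have : r ≤ v x := hx
    linarith
  · have hx' : r / 2 < v x := hx.1
    rw [hadm.ext_eqOn b hC hr hx'.le]
    exact hgZ ⟨lt_trans (half_pos hr) hx', hx.2⟩

variable {ε : ℝ} (hε : 0 < ε) {P : ℝ → Prop} (R : S.GoodSeq hS hv ε P) (hvε : ∀ x, v x ≤ ε)
  (hI : ∫⁻ x, admWeight v d x ∂S.variation ≠ ⊤)

/-- **The admissible push-forward of a rectifiable current is rectifiable** [Federer1969, 4.2.9:
"`(σ_m ∘ τ_a)_{#v} T … ∈ 𝓡_m(ℝⁿ)`" via 4.1.30], here for `g` smooth off a `‖S‖`-null closed set and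
mapping `{v > 0} ∩ B` (`B` open, `spt S ⊆ B`) into a compact `K`: the `P_{r_j}` are rectifiable with
supports in `K` and `Σ 𝐌(P_{r_{j+1}} − P_{r_j}) < ∞`, so their `𝐌`-limit is rectifiable
(`Current.IsRectifiable.exists_limit_of_tsum_mass_ne_top`) and equals the weak limit `g_{#v} S`.
[cite: Federer1969, 4.1.24, 4.1.30, 4.2.2] -/
theorem Current.IsRectifiable.admPushLim (hSr : S.IsRectifiable) {O : Set V} (hO : IsOpen O)
    (hgO : ∀ x ∈ O, ContDiffAt ℝ ∞ g x) (hnull : S.variation Oᶜ = 0) {B : Set V} (hB : IsOpen B)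
    (hSB : S.support ⊆ B) {K : Set V} (hK : IsCompact K) (hgK : Set.MapsTo g ({x | 0 < v x} ∩ B) K) :
    (S.admPushLim b hS hsupp hv hadm hC hε R hvε hI).IsRectifiable := by
  set F := S.admFamily b hS hsupp hv hadm hC
  have hseq : ∀ j, F.seq hε R j = S.admPush b hS hsupp hv hadm hC (R.pos hε j) (R.good j) := fun j => rfl
  have hrect : ∀ j, (F.seq hε R j).IsRectifiable := fun j =>
    hSr.admPush b hS hsupp hv hadm hC hO hgO hnull (R.pos hε j) (R.good j)
  have hsuppK : ∀ j, (F.seq hε R j).support ⊆ K := fun j =>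
    S.support_admPush_subset' b hS hsupp hv hadm hC (R.pos hε j) (R.good j) hB hSB hK.isClosed hgK
  have htsum : ∑' j, (F.seq hε R (j + 1) - F.seq hε R j).mass ≠ ⊤ :=
    ne_top_of_le_ne_top (ENNReal.mul_ne_top F.K_ne_top hI) (F.tsum_mass_seq_sub_le hε R)
  obtain ⟨T', hT'r, -, hlim⟩ := Current.IsRectifiable.exists_limit_of_tsum_mass_ne_top hK _ hrect hsuppK htsum
  -- the `𝐌`-limit is the weak limit
  have heq : S.admPushLim b hS hsupp hv hadm hC hε R hvε hI = T' := by
    ext φ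
    have t1 := S.tendsto_admPush b hS hsupp hv hadm hC hε R hvε hI φ
    obtain ⟨Cφ, hCφ, hφ⟩ := φ.exists_norm_le
    have hev : ∀ᶠ j in atTop, (F.seq hε R j - T').mass < 1 := hlim (Iio_mem_nhds one_pos)
    have t2 : Tendsto (fun j => F.seq hε R j φ - T' φ) atTop (𝓝 0) := by
      have hlim' : Tendsto (fun j => Cφ * (F.seq hε R j - T').mass.toReal) atTop (𝓝 0) := by
        have := ((ENNReal.tendsto_toReal ENNReal.zero_ne_top).comp hlim).const_mul Cφ
        simpa using this
      refine squeeze_zero_norm' ?_ hlim'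
      filter_upwards [hev] with j hj
      rw [Real.norm_eq_abs]
      have := (F.seq hε R j - T').abs_apply_le_mul_toReal_mass hj.ne_top hCφ hφ
      simpa using this
    have t2' : Tendsto (fun j => F.seq hε R j φ) atTop (𝓝 (T' φ)) := by
      have := t2.add_const (T' φ)
      simpa using this
    simp only [hseq] at t2'
    exact tendsto_nhds_unique t1 t2'
  rw [heq]; exact hT'r

end AdmissibleRectifiable


end Literature.Geometry.GeometricMeasureTheory
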